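import Summits.BirchSwinnertonDyer.BirchSwinnertonDyer.Theorems.SignedLowerHalvesSmallImageLowerHalfBothSignsRttCharRoadE1CoresPair
import Literature.NumberTheory.EllipticCurves.SelmerPInftyRestriction
import Literature.NumberTheory.EllipticCurves.GeomPointsGaloisModule
import HarnessLib

/-!
# Route `SignedLowerHalves`, crux L `SmallImageLowerHalfBothSigns` (stmt-BirchSwinnertonDyer-23599), line `rtt_w3` v12 — glue brick F-small «THE CARTAN PREIMAGE IS `Γ_K`»:
# under the registered stub's hypotheses `hKU` (`ρ̄(Γ_K) ⊆ kˣ`) and `hUle` (`ρ̄⁻¹(kˣ) ⊆ res(Γ_K)`), the subgroup `ρ̄⁻¹(kˣ) ≤ Γ_ℚ` on which block I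
# (`exists_injective_corH1_pair_geomTorsion`, p767436) is stated EQUALS `galRange K` on which -w3 g17's corestriction / D3-W chain is stated
# (`N = (galRange K).subgroupOf (κ.layerSubgroup n)`, p766553/p767713) — so the two halves of the glue speak about the same `N`.

LEAD `cruxlead-stmt-BirchSwinnertonDyer-23599` g7 (cell `bsd-ssimc`; `--supports stmt-BirchSwinnertonDyer-23599 --as helper`). THEOREMS ONLY (no definition, no named fact,
no instance, no `sorry`). BSD / crux L / INJ_top are NOT proved here.

WHAT: ★ `comap_unitGroup_eq_galRange`, `subgroupOf_comap_unitGroup_eq`.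

References: [Serre1972] §2.2 (the non-split Cartan and its normaliser); [SerreGaloisCohomology1997] II §1.1.
-/

set_option autoImplicit false
set_option linter.dupNamespace false -- D-0017: single-problem summit, the namespace repeats the problem name by design
noncomputable section

open scoped Classical MatrixGroups

namespace Summit.BirchSwinnertonDyer.BirchSwinnertonDyer.Theorems.SmallImageCharSignedSelmer

open Literature.NumberTheory.GaloisRepresentations Literature.NumberTheory.GaloisRepresentations.Serre1972
  Literature.NumberTheory.EllipticCurves WeierstrassCurve

variable (W : WeierstrassCurve ℚ) {p : ℕ} [Fact p.Prime] (K : Type) [Field K] [NumberField K]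

/-- ★ **`ρ̄⁻¹(kˣ) = galRange K`** from `hKU` and `hUle` (with `resGal = absGaloisRestrict`). [cite: Serre1972, §2.2] -/
theorem comap_unitGroup_eq_galRange (Φ : Multiplicative (AddAut (geomTorsion W p)) ≃* GL (Fin 2) (ZMod p))
    (k : Subalgebra (ZMod p) (Matrix (Fin 2) (Fin 2) (ZMod p)))
    (hUle : ((unitGroup k).comap Φ.toMonoidHom).comap (galoisRepTorsion W p) ≤ (absGaloisRestrict ℚ K).toMonoidHom.range)
    (hKU : ∀ τ : Field.absoluteGaloisGroup K, Φ (galoisRepTorsion W p (absGaloisRestrict ℚ K τ)) ∈ unitGroup k) :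
    ((unitGroup k).comap Φ.toMonoidHom).comap (galoisRepTorsion W p) = galRange (K := ℚ) K := by
  ext g
  constructor
  · intro hg
    obtain ⟨τ, rfl⟩ := hUle hg
    exact ⟨τ, by rw [resGal_eq_absGaloisRestrict]; rfl⟩
  · rintro ⟨τ, rfl⟩
    rw [Subgroup.mem_comap, Subgroup.mem_comap]
    have h := hKU τ
    rw [← resGal_eq_absGaloisRestrict] at h
    exact h

/-- The same inside a subgroup `H ≤ Γ_ℚ` (`N` of block I = `N` of the D3-W chain). [cite: Serre1972, §2.2] -/
theorem subgroupOf_comap_unitGroup_eq (Φ : Multiplicative (AddAut (geomTorsion W p)) ≃* GL (Fin 2) (ZMod p))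
    (k : Subalgebra (ZMod p) (Matrix (Fin 2) (Fin 2) (ZMod p)))
    (hUle : ((unitGroup k).comap Φ.toMonoidHom).comap (galoisRepTorsion W p) ≤ (absGaloisRestrict ℚ K).toMonoidHom.range)
    (hKU : ∀ τ : Field.absoluteGaloisGroup K, Φ (galoisRepTorsion W p (absGaloisRestrict ℚ K τ)) ∈ unitGroup k)
    (H : Subgroup (Field.absoluteGaloisGroup ℚ)) :
    (((unitGroup k).comap Φ.toMonoidHom).comap (galoisRepTorsion W p)).subgroupOf H = (galRange (K := ℚ) K).subgroupOf H := by
  rw [comap_unitGroup_eq_galRange W K Φ k hUle hKU]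

end Summit.BirchSwinnertonDyer.BirchSwinnertonDyer.Theorems.SmallImageCharSignedSelmer

end
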